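import Mathlib
import HarnessLib
import HarnessLib.Audit
import Summits.CriticalPhenomena.Statement
import Literature.Probability.Percolation.CriticalContinuityProofs

/-!
Route: PercMinContact

DORMANT since 2026-08-23T12:30:58Z (reconciler: no traction for 6.1 d (last activity item-evidence-added at 2026-08-17T10:02:04Z); parked, not closed — `ledger route dormant route-CriticalPhenomena-PercMinContact --off` to reactivate) — unstaffed, not closed; items shared with open routes are served there. `ledger route dormant <id> --off` reactivates.

# Route PercMinContact — swallowed finitely often — θ(p_c) ≤ ∫ m(u)du/(1−u), m = expected min of
adjacent distinct cluster sizes; continuity iff m integrable at p_c⁻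

It suffices to show X = SwallowTail (card swallow-inequality-coalescent-balance, K1): the
MIN-CONTACT FUNCTION of bond
percolation on ℤ³, m(u) := E_u[ Σ_{y ~ 0} min(|C(0)|, |C(y)|) · 1{0 ↮ y} ] (sum over the six
neighbours of the origin; cluster
sizes in ℕ∞; = 6·m_min of the card by lattice symmetry), is Lebesgue-integrable on some left
neighbourhood (p, p_c) of
p_c = criticalProb (zdGraph 3) 0. The route's theorem-level glue is the SWALLOW INEQUALITY (support
SwallowInequality, provable
now): θ(p_c) ≤ ∫_p^{p_c} m(u) du/(1−u) for every p < p_c — Russo's formula for the bounded probe g_N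
= min(|C(0)|, N)/N, whose
two-cluster merger term is kept UNFACTORISED (kernel a·φ_N(a,b) ≤ min(a,b), constant 1) instead of
BK-factorised as in
Aizenman–Barsky / Grimmett1999 Lemma (5.51), then N → ∞ by dominated convergence. In coupling
language X says the origin's
cluster is swallowed (absorbed by a cluster at least its own size) finitely often in mean as the
level rises to p_c; the
assembly X → θ(p_c) = 0 is proved sorry-free in the planner's Sketch.lean (theorem assembly_holds =
the deciding theorem).
Lean: `∃ p : ℝ, p < Literature.Probability.Percolation.criticalProb
(Literature.Probability.LatticeModels.zdGraph 3) 0 ∧ ∫⁻ u in Set.Ioo p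
(Literature.Probability.Percolation.criticalProb (Literature.Probability.LatticeModels.zdGraph 3)
0), (∫⁻ ω, ∑ y ∈ (Literature.Probability.LatticeModels.zdGraph 3).neighborFinset (0 :
Literature.Probability.LatticeModels.Site 3), (Literature.Probability.Percolation.openConn (0 :
Literature.Probability.LatticeModels.Site 3) y)ᶜ.indicator (fun ω => min
((Literature.Probability.Percolation.openCluster ω 0).encard : ENNReal)
((Literature.Probability.Percolation.openCluster ω y).encard : ENNReal)) ω
∂(Literature.Probability.Percolation.bondPercolation (Literature.Probability.LatticeModels.zdGraph
3) (Set.projIcc (0 : ℝ) 1 zero_le_one u))) < ⊤`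

## Assembly
Pure measure theory plus 0 < p_c(ℤ³) < 1 (Grimmett1999_criticalProb_pos_lt_one_holds, PROVED): if
θ(p_c) > 0, SwallowTail gives p₀ < p_c
with ∫_{(p₀,p_c)} m < ∞; absolute continuity of the finite set-integral
(exists_pos_setLIntegral_lt_of_measure_lt — no measurability of m
needed) gives p ∈ [p₀, p_c) with ∫_{(p,p_c)} m < (1 − p_c)θ(p_c); SwallowInequality at p and (1−u)⁻¹
≤ (1−p_c)⁻¹ on (p,p_c) give
θ(p_c) ≤ (1−p_c)⁻¹ ∫_{(p,p_c)} m < θ(p_c), contradiction; θ ≥ 0 finishes. Sorry-free in Sketch.lean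
(assembly_holds, lean check rc 0)
and verbatim the body of the deciding theorem `closes` (glue.lean), whose only used hypotheses are
SwallowTail and SwallowInequality.

Rationale: WHY THIS LINE. Differentiate in p a BOUNDED probe of the cluster size (Aizenman–Barsky's ghost
magnetisation 1 − E e^{−h|C|}, Grimmett1999 §5.3, or
here the linear truncation min(|C|,N)/N): Russo's formula plus translation-invariant mass transport
writes the p-derivative as an
expectation over the closed edges at the origin of a MERGER KERNEL of the two adjacent cluster
sizes, and for a bounded probe that
kernel is at most min(a,b) — not the product ab of χ′ and not the one-cluster quantities that the
BK-factorised inequalities in print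
produce (Grimmett1999 Lemma (5.51): (1−p)∂θ/∂p ≤ 2d(1−γ)θ ∂θ/∂γ; AizenmanBarsky1987; Newman1986's γ
≥ 2 criterion, whose quantitative
form is PROVED in the tree, Literature.Barriers.CriticalPhenomena.SubexponentialGrowthZdNarrow via
Hutchcroft2022Triangle Thm 1.3).
Integrating from p to p_c and letting N → ∞ gives θ(p_c) ≤ ∫_p^{p_c} m/(1−u) unconditionally, so
continuity of θ at p_c on ℤ³
becomes a first-moment statement about Kruskal's coalescent driven by subcritical percolation: the
adjacency of COMPARABLE finite
clusters must be integrable in the level — an UPPER-bound question, the orientation in which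
p-uniform two-cluster technology exists
(AizenmanKestenNewman1987 uniqueness counting, Cerf2015, the two-ghost inequality arXiv:1808.08940 /
Hutchcroft2021 Thm 1.5, 3.1:
Σ_e P_p(endpoints of e in distinct clusters each ≥ n) ≤ 66·deg·√((1−p)/(pn)) for ALL p). Imported
areas: coagulation /
coalescent kinetics (merger kernels: the min kernel vs Smoluchowski's multiplicative kernel of
mean-field percolation), monotone
couplings and minimal-spanning-forest merging (swallow count ≤ log₂|C|), and the ghost-field
calculus of AizenmanBarsky1987; the card's
operator dictionary (zero-mode projector of the percolation Laplacian, Steiner merger identity)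
motivates the min/reduced-mass kernel
but is not load-bearing. What it does that prior routes and the negatives index do not:
PercTruncatedSusceptibility / PercAntiMeanFieldOnset
count contacts of finite clusters with the INFINITE cluster at a percolating p (χ^f, bridges); the
in-tree Newman/Hutchcroft criterion
needs a LOWER-bound-type control of χ (γ < 2, false in d = 2, margin 0.2 in d = 3); this line counts
finite–finite mergers strictly
below p_c with the min kernel, is scaling-sharp (tail ≍ s^β, integrable iff β > 0; correct in d = 2)
and rigorously sharp modulo a
log-moment (support LogMomentConverse). Negatives index (5 items: SAW ×3, Cardy ×1,
PercQuarantineIslands finite-box quarantine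
inequality): nothing on merger kernels, ghost fields or p-integrated functionals.

RANKED CRUXES. #2 SwallowTail (crux) — K1 of the card (SWALLOW TAIL, min-contact form): there is p <
p_c(ℤ³) such that ∫_{(p,p_c)} m(u) du < ∞, where m(u) = E_u[Σ_{y~0} min(|C(0)|,|C(y)|)·1{0↮y}] for
bond percolation on zdGraph 3 at level projIcc u (Lebesgue integral in [0,∞]; the integrand is a
limit of polynomials in u, hence Borel). Equivalent (up to the factor (1−u)⁻¹ ≤ (1−p_c)⁻¹ and
constants) to finite mean swallow count E N_min(0;(p,p_c)) < ∞ in the monotone coupling. With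
SwallowInequality it gives θ(p_c) = 0 (assembly proved); with LogMomentConverse it is implied by
θ(p_c) = 0 plus E_{p_c} log(1+|C|) < ∞, so its content is exactly 'no first-order transition',
transported to a subcritical, monotone-in-the-level, two-cluster adjacency functional. Scaling
prediction m(p_c − s) ≍ s^{β−1} (tail ≍ s^β, β(3) ≈ 0.42). [difficulty: open-problem] (why it might
fail: Equivalent to the conjunct modulo E_{p_c}log|C|<∞ (LogMomentConverse + SwallowInequality),
hence false exactly in a jump world; no existing tool bounds a two-cluster adjacency functional
p-uniformly up to p_c in d=3 (sharpness constants degenerate at p_c). ENTRY TEST for any line on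
this node (learned 2026-08-17 from MinContactExponent's dead line): a one-cluster currency E_u|C|^s
≤ Cε^{-a}, a < 2s, IS the conjunct by Hutchcroft2022 Thm 1.3 + Markov — admissible gains are
two-cluster AND level-dependent.) [Newman1986, AizenmanBarsky1987, Grimmett1999, arXiv:2401.12397,
arXiv:1808.08940, Hutchcroft2022Triangle]
#3 MinContactExponent (support since 2026-08-17 — BANKED ENGINE, was crux r3; item
stmt-CriticalPhenomena-17974 since rev 6, successor of the MOOT stmt-CriticalPhenomena-11498 which
keeps the stubs / evidence / landed dividends; see the death record at the end of this entry) — K2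
of the card in statement form (SWALLOW-RATE EXPONENT): there are C and a₀ < 1 with m(u) ≤ C (p_c −
u)^{−a₀} for all 0 ≤ u < p_c. The natural output of any exponent technology and the meeting point of
the card's two engines: (i) 'fractal-boundary BGN' — conditionally on C(0) = A the outside is fresh
Bernoulli(u) on ℤ³∖A, so m(u) ≤ 2 E_u[Σ_{(x,y)∈∂C(0)} P_u(y joins ≥ |A| vertices in
ℤ³∖A)|_{A=C(0)}], and a re-entry exponent P ≤ C|A|^{−κ} averaged over A ~ C(0) with κ > (γ−1)/Δ ≈
0.36 suffices; (ii) the two-arm/window engine TwoArmWindow (gives a₀ = Δ₀(1−λ)+). Truth: a₀ = 1 − β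
≈ 0.58. Implies SwallowTail by ExponentGlue (∫ (p_c−u)^{−a₀} < ∞). [difficulty: open-problem] (why
it might fail: Truth a₀=1−β≈0.58 needs β>0 seen quantitatively from below p_c; the free p-uniform
input (two-ghost, n^{-1/2}) summed against the true window s^{-2.21} only gives a₀≈1.1>1, and a
sup-over-shapes re-entry bound is false (a straight segment sees bulk, κ≈0.19<0.36).) DEATH RECORD
(route-repair 2026-08-17): its only line `birth` (square-root split at the two-ghost exponent: stub
A = conditional two-ghost T_n ≤ C n^{-1/2} P_u(|C|≥n), stub B = half-moment exponent Σ_n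
n^{-1/2}P_u(|C|≥n) ≤ Cε^{-a₀}, a₀<1) is DEAD as a COSTUME — stub B ALONE ⇒ the conjunct
(Theorems.percolationContinuityZ3_of_halfMomentExponent, p146286: Hutchcroft2022 Thm 1.3 + Markov in
√n, n = ⌈ε^{-2}⌉), and no reshape survives: every one-cluster currency E_u|C|^s ≤ Cε^{-a} with a <
2s is conjunct-strength, ExponentGlue forces a < 1, so s ≥ 1/2 is costume and s < 1/2 pushes the
two-cluster stub past the two-ghost frontier 1/2 (rigorous conditional frontier 1/4,
condTwoGhost_quarter p146602) with < 0.05 of predicted margin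
(Cruxes/MinContactExponent/Lines/birth-dead.md, leads c2/c3). Stub B was expired from the registry
and the item re-badged support: it is a sufficient power-law FORMAT of the thesis, not a research
obstruction of its own; ExponentGlue (PROVED) still turns any future exponent bound into SwallowTail
by name. SHARPENED 2026-08-17 (strategist census Cruxes/SwallowTail/STRATEGY-CENSUS.md (F2)/(F2′);
lead c3, p151180/p151742): a factorised bound T_n ≤ C n^{−q} P_u(|C|≥n)^r has a costume one-cluster
partner iff q ≤ 1/2, and in d = 3 every SHARP pointwise partner Σ_n n^{−q}P^r ≤ Cε^{−a₀} is costume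
(Δ − 2 < β): one-cluster information must be consumed LEVEL-INTEGRATED (SwallowTail), never
pointwise (this item); unconditionally m(u) ≤ C_θ χ(u)^{1−θ/2} for every θ < 1, and
MinContactExponent ⇐ γ′ < 2 — the route's own mooting hypothesis. The item carries no skeleton or
stubs on purpose and is no hypothesis of `closes` since rev 7. [arXiv:1808.08940, Hutchcroft2021,
Hutchcroft2022Triangle, Cerf2015, AizenmanKestenNewman1987, BarskyGrimmettNewman1991,
WangZhouZhangGaroniDeng2013]
#4 TwoArmWindow (crux) — K3 of the card (FACTORISED ENGINE), recorded so that provers see the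
thresholds: there are 0 ≤ λ < 1, Δ₀ > 0 with Δ₀(1−λ) < 1, and constants C, c > 0, such that for
every u < p_c (a) the p-UNIFORM VOLUME TWO-ARM bound Σ_{y~0} P_u(|C(0)| ≥ n, |C(y)| ≥ n, 0 ↮ y) ≤ C
n^{−λ} holds for all n ≥ 1, and (b) the SUBCRITICAL VOLUME WINDOW P_u(|C(0)| ≥ n) ≤ C exp(−c n (p_c
− u)^{Δ₀}) holds for all n. By the layer-cake identity m(u) = Σ_{n≥1} Σ_y P_u(|C(0)| ≥ n, |C(y)| ≥
n, 0↮y), splitting at N ≍ (p_c−u)^{−Δ₀} log gives m(u) ≲ (p_c−u)^{−Δ₀(1−λ)}·log, so TwoArmWindow →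
SwallowTail (support TwoArmGlue). Rigorous today: λ = 1/2 for all p (two-ghost inequality), which
would need Δ₀ < 2; truth Δ = β + γ ≈ 2.21, so the crux needs λ > 1 − 1/Δ ≈ 0.55 (card's Monte-Carlo
prediction λ ≈ 0.74, jobs j002632–7 queued at filing, unverified) together with a window Δ₀ ∈ [2.21,
1/(1−λ)). [difficulty: open-problem] (why it might fail: Needs λ>1−1/Δ≈0.55 uniformly in p
(rigorous: λ=1/2, arXiv:1808.08940; improving it needs an a-priori volume tail of conjunct strength,
Hutchcroft2021 Thm 3.1) AND a polynomial window (rigorous in d=3 only ξ≤exp(C/s²),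
DuminilcopinKozmaTassion2020).) [arXiv:1808.08940, Hutchcroft2021, Hutchcroft2020,
DuminilcopinKozmaTassion2020, Grimmett1999, WangZhouZhangGaroniDeng2013]
#9 SwallowInequality (support) — THE SWALLOW INEQUALITY (card P1, unfactorised Aizenman–Barsky): for
every real p < p_c, θ(p_c) ≤ ∫_{(p,p_c)} (1−u)⁻¹ m(u) du in [0,∞]. Proof (checked on paper; ~10
lines, all d, any transitive amenable graph): g_N := min(|C(0)|,N)/N = N⁻¹Σ_{k≤N} 1{|C(0)| ≥ k} is a
positive combination of increasing LOCAL events, so u ↦ E_u g_N is a polynomial and Russo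
(russo_formula_holds, PROVED) gives d/du E_u g_N = Σ_e P_u(e pivotal)… = (1/(1−u))
E_u[Σ_{e=(x,y)∈∂C(0)} φ_N(|C(0)|,|C(y)|)], φ_N(a,b) = (min(a+b,N) − min(a,N))/N (pivotality is
independent of ω_e; opening a closed boundary edge merges exactly C(0) and C(y)); translation
invariance of P_u (bondPercolation_map_shift, PROVED) transports Σ_{x∈C(0)}Σ_{y~x} to
|C(0)|·Σ_{y~0}: d/du E_u g_N = (1/(1−u)) E_u[a Σ_{y~0, 0↮y} φ_N(a,|C(y)|)], a = |C(0)| < N (else φ_N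
= 0); the kernel bound a·φ_N(a,b) = a·min(b,N−a)⁺/N ≤ min(a,b) gives E_{p_c} g_N − E_p g_N ≤
∫_p^{p_c} m(u)du/(1−u); finally θ(p_c) ≤ E_{p_c} g_N (g_N = 1 on {|C| = ∞}) and E_p g_N → θ(p) = 0
as N → ∞ for p < p_c (theta_eq_zero_of_lt_criticalProb_holds + dominated convergence). For p < 0 the
extra piece of the integral is ≥ 0. Grimmett1999 p.105 (C¹ in p of finite-volume quantities, App. I)
and Lemma (5.51) p.106 are the factorised ancestor. [difficulty: M] [Grimmett1999,
AizenmanBarsky1987, Russo1981, LyonsPeres2016]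
#9 LogMomentConverse (support) — SHARPNESS MODULO A LOG-MOMENT (card C3): if θ(p_c) = 0 and
E_{p_c}[log(1 + |C(0)|)] < ∞ then ∫_{(0,p_c)} m(u) du < ∞ (so SwallowTail holds with any p). Proof:
in the monotone coupling (labelMeasure, configOfLabels, map_configOfLabels_holds) let N_sw count the
levels u ∈ (0,p_c) at which an edge of ∂C_u⁻(0) with label u opens onto a cluster of size ≥
|C_u⁻(0)| (a swallow); each swallow at least doubles |C(0)| and C_u(0) ⊆ C_{p_c}(0), so N_sw ≤
log₂|C_{p_c}(0)| pathwise (finite a.s. when θ(p_c) = 0); the compensator identity E N_sw = ∫_0^{p_c}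
(1−u)⁻¹ E_u[Σ_{e∈∂C(0)} 1{|C(y_e)| ≥ |C(0)|}] du (label of e independent of the other labels;
Tonelli) and the transport/reflection bound m(u) ≤ 2 E_u[Σ_{e∈∂C(0)} 1{|C(y_e)| ≥ |C(0)|}] (min(a,b)
≤ a1{b≥a} + b1{a>b}; the point reflection x ↦ y − x swaps 0 and y) give ∫_0^{p_c} m du ≤ ∫_0^{p_c} m
du/(1−u) ≤ 2 E N_sw ≤ (2/log 2) E log(1+|C_{p_c}(0)|) < ∞. Records that SwallowTail is not stronger
than the conjunct by more than a logarithmic moment at p_c. [difficulty: M] [Grimmett1999,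
LyonsPeres2016, AizenmanKestenNewman1987]
#9 ExponentGlue (support) — MinContactExponent → SwallowTail: with p := max(0, p_c/2), ∫_{(p,p_c)} m
≤ ∫ C(p_c−u)^{−a₀} du = C (p_c−p)^{1−a₀}/(1−a₀) < ∞ for a₀ < 1 (if a₀ ≤ 0 the integrand is bounded);
lintegral monotonicity needs no measurability of m; 0 < p_c < 1 is
Grimmett1999_criticalProb_pos_lt_one_holds. [difficulty: provable-now] [Grimmett1999]
#9 TwoArmGlue (support) — TwoArmWindow → SwallowTail: layer cake in [0,∞] (min(a,b) = Σ_{n≥1} 1{a ≥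
n}1{b ≥ n} for a,b ∈ ℕ∞; Tonelli) gives m(u) = Σ_{n≥1} Σ_{y~0} P_u(|C(0)|≥n, |C(y)|≥n, 0↮y); bound
the n-th term by min(C n^{−λ}, 6C e^{−c n s^{Δ₀}}), s = p_c − u, split at N = ⌈(Δ₀+1) s^{−Δ₀}
log(1/s)/c⌉ to get m(u) ≤ C′ s^{−Δ₀(1−λ)} log(e/s)^{1−λ} + C′ for s ≤ s₀, which is integrable on
(p_c − s₀, p_c) because Δ₀(1−λ) < 1; identify the unitInterval level with projIcc u for 0 ≤ u < p_c.
[difficulty: M] [Hutchcroft2021, Grimmett1999]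

TWO-LAYER PLAN. Foreseen, not filed: SwallowInequality ⇐ TruncatedRussoIdentity (d/du E_u g_N =
(1−u)⁻¹E_u[Σ_{∂C(0)} φ_N], finite N, polynomial FTC) →
TransportKernelBound (translation MTP + a·φ_N ≤ min) → SwallowInequality (limit N → ∞), k = 2–3.
SwallowTail ⇐ MinContactExponent
(ExponentGlue, filed, PROVED; MinContactExponent itself banked as support 2026-08-17) and
SwallowTail ⇐ TwoArmWindow (TwoArmGlue, filed, PROVED) are the two engine edges; only the
TwoArmWindow edge is staffed. MinContactExponent ⇐ AveragedReentry
(E_u[Σ_{(x,y)∈∂C(0)} P_u(y joins ≥ |C(0)| vertices off C(0))] ≤ C E_u|C(0)|^{1−κ}, κ > (γ−1)/Δ) →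
FractionalMomentWindow (∫^{p_c} E_u|C|^{1−κ} du < ∞)
— shape known, filed only when a boundary-arm estimate on random domains appears. TwoArmWindow ⇐
UniformTwoArm(λ) + VolumeWindow(Δ₀) as two
children once either half has technology.

KILL CRITERIA. SwallowInequality refuted in Lean can only be a misstatement (the paper proof is
checked: kernel bound, Russo for local increasing events,
translation transport, monotone limits) — repair by restating, never close. SwallowTail refuted
(∫_{(p,p_c)} m = ∞ for every p): by
LogMomentConverse this means θ(p_c) > 0 or E_{p_c}log(1+|C|) = ∞ — close `refuted:SwallowTail`; the
witness is then a serious attack on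
the conjunct itself and goes to the negatives index with that remark. MinContactExponent or
TwoArmWindow refuted: drop that engine
(`--drop`), the line survives on the other and on SwallowTail directly (2026-08-17:
MinContactExponent's only line died as a costume — not a refutation — so it was banked as support
rather than dropped, its decl being unfolded by the landed ExponentGlue proof; the route now stands
on SwallowTail r2 + TwoArmWindow r4); both refuted ⇒ the route keeps only its unconditional half
(SwallowInequality + necessity portrait) and goes dormant. A refuter proving E_{p_c}[log(1+|C|)] < ∞
unconditionally makes SwallowTail
literally equivalent to the conjunct: grade drops to variant, route stays (the inequality and
engines remain the content). The conjunct
proved elsewhere (e.g. a γ < 2 bound through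
SubexponentialGrowthZdNarrow.percolationContinuityZ3_of_powerLaw, or any Perc* route) moots
the route: close superseded.

NOT DECOMPOSED YET. The finite-N Russo identity, the translation mass-transport step and the N → ∞
limits inside SwallowInequality (layer-2 children, see
Two-layer plan); the coupling/compensator bookkeeping of LogMomentConverse; the fractal-boundary
(BGN-with-the-cluster-as-wall) engine behind
MinContactExponent, whose correct AVERAGED form is not yet typable (a sup over shapes is false: a
straight segment sees bulk); the split of
TwoArmWindow into its two halves; constants (6 = 2d, the weight (1−u)⁻¹, a₀ vs 1−β); the
swallow-COUNT form E N_min < ∞ of the crux (needs the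
càdlàg cluster process of the coupling; equivalent to the integral form within a factor 2,
LogMomentConverse's proof); calibrations d = 1
(p_c = 1, m(u) = Θ(1): the integral ∫ du/(1−u) diverges logarithmically — the exact borderline a
jump requires), d = 2 (tail ≍ s^{5/36},
provable in principle from Kesten's scaling relations) and d ≥ 19 (needs the mild two-arm repulsion
beyond BK even there); site percolation
and general d (all items are d = 3 bond).

CHEAPEST FALSIFIER. (1) Vacuity audit (refuters' standard move on this sub-problem): try to prove
SwallowTail ⟺ θ(p_c) = 0 from KNOWN facts — we concede '⇐'
needs the log-moment E_{p_c}log(1+|C|) < ∞ (itself conjunct-strength: any decay of P_{p_c}(|C| ≥ n)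
gives θ(p_c) = 0) and '⇒' IS
SwallowInequality; success downgrades novelty, not validity. (2) Literature lookup: is the
unfactorised min-kernel bound of ∂_p(bounded
probe) printed anywhere (AizenmanBarsky1987 §3–4, Newman 1987c, BarskyGrimmettNewman1991,
Hutchcroft's ghost-field papers arXiv:1808.08940 /
arXiv:1901.10363 / Hutchcroft2021 §3)? I read Grimmett1999 §5.3 pp.105–107 (only the factorised
Lemma (5.51)), Hutchcroft2020 Thm 1.1–1.2
and Hutchcroft2021 Thm 1.5/3.1 (two-ghost: an upper bound on the same two-arm event, used for
different ends) — not found. (3) Numerics: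
the 3-D swallow-tail exponent (card's kit jobs j002888–j002891, union-find on tori, prediction F(s)
∝ s^{0.42±0.05}); a flat tail at
accessible scales kills the real-world premise of SwallowTail/MinContactExponent. Ran myself:
Sketch.lean (lean check rc 0, 0 sorries):
all eight decls elaborate; assembly_holds/closes are kernel-closed.

NUMBERS. p_c(ℤ³, bond) ≈ 0.24881, β ≈ 0.418, γ ≈ 1.79, Δ = β + γ ≈ 2.21, τ − 2 = 1/δ ≈ 0.19, d_f ≈
2.523, ν ≈ 0.876 (WangZhouZhangGaroniDeng2013,
arXiv:1302.0421). Predicted: m(p_c − s) ≍ s^{β−1} = s^{−0.58} (a₀ = 0.58 < 1, margin β); swallow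
tail ∫_{p_c−s}^{p_c} m ≍ s^{0.42}; volume
two-arm exponent needed λ > 1 − 1/Δ ≈ 0.548, rigorous λ = 1/2 (Σ_e P_p(S_{e,n}) ≤
66·deg·√((1−p)/(pn)), arXiv:1808.08940 as quoted in
Hutchcroft2021 p.6; improved Thm 3.1 needs an a-priori tail A n^{−θ}), card's prediction λ ≈ 0.74. d
= 2: β = 5/36, γ = 43/18 > 2 (Newman's
γ < 2 criterion fails there, SmirnovWerner2001), m(p_c−s) ≍ s^{−31/36}, integrable. d = 1: p_c = 1,
θ jumps, ∫^1 m du/(1−u) diverges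
logarithmically. In-tree competitor: θ(p_c) ≤ 16d(p_c−p)²χ(p)/(p_c(1−p_c)²)
(SubexponentialGrowthZdNarrow, PROVED). Constants of this
route: kernel constant 1 (neighbour-sum form), weight (1−u)⁻¹ ≤ (1−p_c)⁻¹ ≈ 1.33. Items at open: 8
(3 cruxes, 4 support, 1 assembly); after the 2026-08-17 badge repair: 8 (2 cruxes, 5 support of
which 4 PROVED + banked MinContactExponent, 1 assembly PROVED); deciding theorem since rev 7:
`closes (h_SwallowTail) (h_SwallowInequality) : PercolationContinuityZ3` — one load-bearing open
binder (SwallowTail); TwoArmWindow enters the cone through TwoArmGlue (PROVED), MinContactExponent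
through ExponentGlue (PROVED).

DEFINITION REQUESTS. None filed. Everything is stated over the prelude (bondPercolation,
openCluster, openConn, openGraph, theta, criticalProb, criticalProbI,
zdGraph, neighborFinset; `lean search --decl` checked, Sketch.lean rc 0). A Literature notion
`minContact d p : ℝ≥0∞ :=
∫⁻ ω, Σ_{y ∈ neighborFinset 0} 1{0↮y}·min(|C(0)|,|C(y)|) ∂P_p` (Literature/Probability/Percolation)
would shorten five of the eight
signatures; deliberately not requested at open so that no item waits on a definition. No cite facts
wanted: the two-ghost inequality
(arXiv:1808.08940) is context for TwoArmWindow, not a hypothesis of any item.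

Novelty: Searches (2026-08-15): `lit search --hybrid "two-ghost inequality percolation distinct clusters
Hutchcroft critical exponent inequalities"` (12 held books, none relevant; FTS leg busy); `lit
vsearch "<jump ⇒ expected number of closed edges joining C(0) to a larger cluster diverges; min of
the two merged cluster sizes>"` (10 held docs, none states it); `lit galaxy search "smaller of the
two clusters" --star all` (15 rows, none relevant); `lit search --source arxiv|zbmath "...merging
clusters criterion continuity..."` (0, 0); OpenAlex HTTP 429 (daily budget); `lit read
arXiv:2008.11197` pp.6–7, 15 (two-ghost inequality of arXiv:1808.08940 quoted with constant 66; Thm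
1.5; Thm 3.1 read); `lit read arXiv:1901.10363` pp.2–5 (Hutchcroft2020 Thm 1.1–1.2, the
ghost-field/OSSS volume inequality); `lit read Grimmett1999` PDF pp.118–120 (§5.3: p.105 C¹-in-p
remark, Lemma (5.51) (1−p)∂θ/∂p ≤ 2d(1−γ)θ∂θ/∂γ, Lemma (5.53)); `lean search` (two-ghost not in
tree; SubexponentialGrowthZdNarrow = in-tree Newman/Hutchcroft γ<2 criterion, PROVED;
russo_formula_holds, bondPercolation_map_shift, tsum_eq_tsum_of_isGraphUnimodular PROVED); `ledger
negatives --problem CriticalPhenomena` (5, none related); the card's own documented searches (galaxy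
--mode intelligent ×2 on 'minimum of the two cluster sizes merged' / 'Kruskal invasion sizes of the
two clusters that merge', zbMATH, KozmaNitzan2024 pp.2, 38, Cerf2015 §1,
VandenbergVanengelenburg2022 §1 read) found nothing of min-kernel form.
Nearest prior  [refs: 10.1007/bf01021076, 2008.11197, 1808.08940, 1901.10363, doi:10.1007/bf01021076, Hutchcroft2020, Grimmett1999, KozmaNitzan2024, Cerf2015, VandenbergVanengelenburg2022, AizenmanBarsky1987, Newman1986, Hutchcroft2021]

Barriers (technique_class: ghost-field-russo, coalescent, min-kernel): - technique_class: ghost-field-russo, coalescent, min-kernel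
- Literature.Barriers.CriticalPhenomena.SprinklingRenormalisation: not in class — no blocks, no
sprinkled parameter p + η; p enters only through Russo's formula at fixed level and an exact
integral in the level, whose upper limit IS p_c.
- Literature.Barriers.CriticalPhenomena.SlabLimitUniformControl: no slabs and no limit interchange;
the 'uniform control up to p_c' this barrier asks of slab methods is replaced by integrability of a
subcritical moment, and the factorised failure mode of that replacement is logged openly as
TwoArmWindow's thresholds.
- Literature.Barriers.CriticalPhenomena.TransverseCrossingsNeedNotMeet: no crossings, circuits or
path intersections anywhere in the line.
- Literature.Barriers.CriticalPhenomena.SubexponentialGrowthZdNarrow: this IS a 'subcritical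
strategy', but its passage across p_c is QUANTITATIVE (an exact identity integrated to p_c plus a
finite-integral hypothesis), not a p-uniform RATE plus lower semicontinuity, which is exactly the
sub-family the narrowed barrier voids on ℤ^d; like the proved entropic-sprinkling criterion in that
file, it reduces the conjunct to a subcritical bound — a different one (two-cluster, min kernel)
that does not need γ < 2.
- Literature.Barriers.CriticalPhenomena.LongRangeDiscontinuity: respected, not evaded — the swallow
inequality holds verbatim for the Aizenman–Newman 1/r² family and there correctly reports a
NON-integrable min-contact function (ba

Novelty grade: new-combination — Refuter grade (g44-6). Nearest prior art: p-derivative of a bounded cluster probe with the two-cluster merger term BK-FACTORISED (Aizenman–Barsky 1987; Grimmett1999 Lemma (5.51)); p-uniform two-arm volume bound (two-ghost, arXiv:1808.08940 / Hutchcroft2021) used for locality, never integrated in the (refuter refuter-refute-pool-g44-6, 2026-08-15T18:33:16Z; prior: Grimmett1999 Lemma (5.51) p.106, AizenmanBarsky1987, arXiv:1808.08940 (two-ghost), Hutchcroft2021 Thm 1.5/3.1, Newman1986 doi:10.1007/bf01021076, NewmanZiff2001 cond-mat/0101295 (union-by-size folklore))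

History (route lifecycle, newest last):
- 2026-08-17T07:20:28Z · skeleton.hides-summit: stub_halfMomentExponent (stmt-CriticalPhenomena-11498) ⟷ summit (accepted theorem in Summits/CriticalPhenomena/PercolationContinuityZ3/Theorems/PercMinContactMinContactExponentHalfMomentContinuity.lean) (prover-line-stmt-CriticalPhenomena-11498-c2-0)
- 2026-08-17T09:29:22Z · rev 6: dropped MinContactExponent — route-repair(badge, gen 3), un-wedge: rev 6 (09:18Z) stored kind `aside` on MinContactExponent via --retriage (as lean/CONVENTIONS/BC6 text instructs) but this (planner-rbadge-CriticalPhenomena-PercMinContac-0eba6928-g3-0)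
- 2026-08-23T12:30:58Z · DORMANT — reconciler: no traction for 6.1 d (last activity item-evidence-added at 2026-08-17T10:02:04Z); parked, not closed — `ledger route dormant route-CriticalPhenomen (operator:999:3171769)

sub-problem: PercolationContinuityZ3 · status: dormant · opened planner-plancard-CriticalPhenomena-Percolatio-eca10a61-0 2026-08-15T18:14:04Z · rev 9 · ledger route-CriticalPhenomena-PercMinContact
GENERATED by the gate from the ledger (D-0016/17). Provers cite these decls: `theorem foo : Summit.CriticalPhenomena.PercolationContinuityZ3.Theses.PercMinContact.<Decl> := …` in Summits/CriticalPhenomena/PercolationContinuityZ3/Theorems/<Name>.lean.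
-/

namespace Summit.CriticalPhenomena.PercolationContinuityZ3.Theses.PercMinContact

open scoped BigOperators Topology Manifold Classical MeasureTheory ProbabilityTheory Matrix InnerProductSpace ComplexConjugate ContinuousMap
open Filter Set Function TopologicalSpace MeasureTheory

attribute [summit_statement] _root_.PercolationContinuityZ3

/-- item stmt-CriticalPhenomena-11497 · crux · rank 2 · open · by planner
why it might fail: ≡ conjunct mod E_{p_c}log|C| (LogMomentConverse, PROVED): false only in a jump/barely-continuous world. Factorised lines A(q,r)∧B(q,r): partner B is costume iff q≤1/2 (KL+Markov, p146286), so stub A must beat two-ghost's 1/2 p-uniformly (line root_tail_split: q=11/20, 0.05 past every proved bound).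
sources: Newman1986, AizenmanBarsky1987, Grimmett1999, arXiv:1808.08940, Hutchcroft2021, Hutchcroft2022Triangle
[crux] K1 of the card (SWALLOW TAIL, min-contact form): there is p < p_c(ℤ³) such that ∫_{(p,p_c)}
m(u) du < ∞, where m(u) = E_u[Σ_{y~0} min(|C(0)|,|C(y)|)·1{0↮y}] for bond percolation on zdGraph 3
at level projIcc u (Lebesgue integral in [0,∞]; the integrand is a limit of polynomials in u, hence
Borel). Equivalent (up to the factor (1−u)⁻¹ ≤ (1−p_c)⁻¹ and constants) to finite mean swallow count
E N_min(0;(p,p_c)) < ∞ in the monotone coupling. With SwallowInequality it gives θ(p_c) = 0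
(assembly proved); with LogMomentConverse it is implied by θ(p_c) = 0 plus E_{p_c} log(1+|C|) < ∞,
so its content is exactly 'no first-order transition', transported to a subcritical,
monotone-in-the-level, two-cluster adjacency functional. Scaling prediction m(p_c − s) ≍ s^{β−1}
(tail ≍ s^β, β(3) ≈ 0.42). [difficulty: open-problem] -/
@[route_item "route-CriticalPhenomena-PercMinContact"]
def SwallowTail : Prop :=
  ∃ p : ℝ, p < Literature.Probability.Percolation.criticalProb (Literature.Probability.LatticeModels.zdGraph 3) 0 ∧ ∫⁻ u in Set.Ioo p (Literature.Probability.Percolation.criticalProb (Literature.Probability.LatticeModels.zdGraph 3) 0), (∫⁻ ω, ∑ y ∈ (Literature.Probability.LatticeModels.zdGraph 3).neighborFinset (0 : Literature.Probability.LatticeModels.Site 3), (Literature.Probability.Percolation.openConn (0 : Literature.Probability.LatticeModels.Site 3) y)ᶜ.indicator (fun ω => min ((Literature.Probability.Percolation.openCluster ω 0).encard : ENNReal) ((Literature.Probability.Percolation.openCluster ω y).encard : ENNReal)) ω ∂(Literature.Probability.Percolation.bondPercolation (Literature.Probability.LatticeModels.zdGraph 3) (Set.projIcc (0 : ℝ)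 1 zero_le_one u))) < ⊤

/-- item stmt-CriticalPhenomena-11499 · crux · rank 4 · open · by planner
why it might fail: Needs λ>1−1/Δ≈0.55 p-uniformly (rigorous 1/2 two-ghost; line: λ≥3/5 on u>1/5) AND a gap window Δ₀<1/(1−λ) (line: Δ₀<5/2; rigorous only ξ≤exp(C/s²), arXiv:1902.03207); Δ₀<2 alone ⇒ conjunct (landed percolationContinuityZ3_of_gapWindow_lt_two): the cell [2,5/2) has no technology yet.
sources: arXiv:1808.08940, Hutchcroft2021, Hutchcroft2020, arXiv:1902.03207, DuminilcopinKozmaTassion2020, Grimmett1999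
[crux] K3 of the card (FACTORISED ENGINE), recorded so that provers see the thresholds: there are 0
≤ λ < 1, Δ₀ > 0 with Δ₀(1−λ) < 1, and constants C, c > 0, such that for every u < p_c (a) the
p-UNIFORM VOLUME TWO-ARM bound Σ_{y~0} P_u(|C(0)| ≥ n, |C(y)| ≥ n, 0 ↮ y) ≤ C n^{−λ} holds for all n
≥ 1, and (b) the SUBCRITICAL VOLUME WINDOW P_u(|C(0)| ≥ n) ≤ C exp(−c n (p_c − u)^{Δ₀}) holds for
all n. By the layer-cake identity m(u) = Σ_{n≥1} Σ_y P_u(|C(0)| ≥ n, |C(y)| ≥ n, 0↮y), splitting at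
N ≍ (p_c−u)^{−Δ₀} log gives m(u) ≲ (p_c−u)^{−Δ₀(1−λ)}·log, so TwoArmWindow → SwallowTail (support
TwoArmGlue). Rigorous today: λ = 1/2 for all p (two-ghost inequality), which would need Δ₀ < 2;
truth Δ = β + γ ≈ 2.21, so the crux needs λ > 1 − 1/Δ ≈ 0.55 (card's Monte-Carlo prediction λ ≈
0.74, jobs j002632–7 queued at filing, unverified) together with a window Δ₀ ∈ [2.21, 1/(1−λ)).
[difficulty: open-problem] -/
@[route_item "route-CriticalPhenomena-PercMinContact"]
def TwoArmWindow : Prop :=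
  ∃ lam Δ₀ C c : ℝ, 0 ≤ lam ∧ lam < 1 ∧ 0 < Δ₀ ∧ Δ₀ * (1 - lam) < 1 ∧ 0 < c ∧ (∀ u : unitInterval, (u : ℝ) < Literature.Probability.Percolation.criticalProb (Literature.Probability.LatticeModels.zdGraph 3) 0 → ∀ n : ℕ, 1 ≤ n → ∑ y ∈ (Literature.Probability.LatticeModels.zdGraph 3).neighborFinset (0 : Literature.Probability.LatticeModels.Site 3), (Literature.Probability.Percolation.bondPercolation (Literature.Probability.LatticeModels.zdGraph 3) u).real {ω | (n : ℕ∞) ≤ (Literature.Probability.Percolation.openCluster ω 0).encard ∧ (n : ℕ∞) ≤ (Literature.Probability.Percolation.openCluster ω y).encard ∧ ¬ (Literature.Probability.Percolation.openGraph ω).Reachable 0 y} ≤ C * (n : ℝ) ^ (-lam)) ∧ (∀ u : unitInterval, (u : ℝ) < Literature.Probability.Percolation.criticalProb (Literature.Probability.LatticeModels.zdGraph 3) 0 → ∀ n : ℕ, (Literature.Probability.Percolation.bondPercolation (Literature.Probability.LatticeModels.zdGraph 3) u).real {ω | (n : ℕ∞) ≤ (Literature.Probability.Percolation.openCluster ω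 0).encard} ≤ C * Real.exp (-(c * n * (Literature.Probability.Percolation.criticalProb (Literature.Probability.LatticeModels.zdGraph 3) 0 - u) ^ Δ₀)))

/-- item stmt-CriticalPhenomena-17974 · support · rank 3 · open · by planner
why it might fail: BANKED (no live line): skeleton birth DEAD as costume — stub_halfMomentExponent ALONE ⇒ conjunct (p146286; stub expired). Census F2′: every factorised line to a POINTWISE power law has a costume (sharp) one-cluster partner in d=3 (Δ−2<β); sup-window split = TwoArmWindow. Do not re-skeleton.
sources: arXiv:1808.08940, Hutchcroft2021, Hutchcroft2022Triangle, Newman1986, Cerf2015, WangZhouZhangGaroniDeng2013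
[support] BANKED ENGINE K2 of the card (SWALLOW-RATE EXPONENT), kept for the record and for the
PROVED by-name edge ExponentGlue (MinContactExponent → SwallowTail): there are C and a₀ < 1 with
m(u) ≤ C (p_c − u)^{−a₀} for all 0 ≤ u < p_c, m(u) = E_u[Σ_{y~0} min(|C(0)|,|C(y)|)·1{0↮y}] (bond
percolation on zdGraph 3 at level projIcc u). Truth under scaling: a₀ = 1 − β ≈ 0.58. STATUS
(2026-08-17): no live line. Its only skeleton `birth` (Cruxes/MinContactExponent/Lines/birth.lean,
sha 7b0dd098; stubs stub_condTwoGhost, stub_halfMomentExponent) is DEAD as costume —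
stub_halfMomentExponent ALONE ⇒ PercolationContinuityZ3
(Theorems.percolationContinuityZ3_of_halfMomentExponent, p146286; stub expired) — and by the
strategist census on SwallowTail (Cruxes/SwallowTail/STRATEGY-CENSUS.md, F2/F2′) every factorised
line toward a POINTWISE power law has a costume sharp one-cluster partner in d = 3 (Δ − 2 < β),
while the non-factorised sup-window split is TwoArmWindow's line verbatim (TwoArmGlue feeds
SwallowTail directly). Not load-bearing for `closes`. Do not re-skeleton through one-cluster
moments; exponent ideas go to SwallowTail (level-integrated) or TwoArmWindow. [difficulty:
open-problem] -/
@[route_item "route-CriticalPhenomena-PercMinContact"]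
def MinContactExponent : Prop :=
  ∃ C a₀ : ℝ, a₀ < 1 ∧ ∀ u : ℝ, 0 ≤ u → u < Literature.Probability.Percolation.criticalProb (Literature.Probability.LatticeModels.zdGraph 3) 0 → (∫⁻ ω, ∑ y ∈ (Literature.Probability.LatticeModels.zdGraph 3).neighborFinset (0 : Literature.Probability.LatticeModels.Site 3), (Literature.Probability.Percolation.openConn (0 : Literature.Probability.LatticeModels.Site 3) y)ᶜ.indicator (fun ω => min ((Literature.Probability.Percolation.openCluster ω 0).encard : ENNReal) ((Literature.Probability.Percolation.openCluster ω y).encard : ENNReal)) ω ∂(Literature.Probability.Percolation.bondPercolation (Literature.Probability.LatticeModels.zdGraph 3) (Set.projIcc (0 : ℝ) 1 zero_le_one u))) ≤ ENNReal.ofReal (C * (Literature.Probability.Percolation.criticalProb (Literature.Probability.LatticeModels.zdGraph 3) 0 - u) ^ (-a₀))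

/-- item stmt-CriticalPhenomena-11500 · support · rank 9 · closed · proved by Summit.CriticalPhenomena.PercolationContinuityZ3.Theorems.swallowInequality_proof @ 7621d4dbdbca (prover) · by planner
sources: Grimmett1999, AizenmanBarsky1987, Russo1981, LyonsPeres2016
[support] THE SWALLOW INEQUALITY (card P1, unfactorised Aizenman–Barsky): for every real p < p_c,
θ(p_c) ≤ ∫_{(p,p_c)} (1−u)⁻¹ m(u) du in [0,∞]. Proof (checked on paper; ~10 lines, all d, any
transitive amenable graph): g_N := min(|C(0)|,N)/N = N⁻¹Σ_{k≤N} 1{|C(0)| ≥ k} is a positive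
combination of increasing LOCAL events, so u ↦ E_u g_N is a polynomial and Russo
(russo_formula_holds, PROVED) gives d/du E_u g_N = Σ_e P_u(e pivotal)… = (1/(1−u))
E_u[Σ_{e=(x,y)∈∂C(0)} φ_N(|C(0)|,|C(y)|)], φ_N(a,b) = (min(a+b,N) − min(a,N))/N (pivotality is
independent of ω_e; opening a closed boundary edge merges exactly C(0) and C(y)); translation
invariance of P_u (bondPercolation_map_shift, PROVED) transports Σ_{x∈C(0)}Σ_{y~x} to
|C(0)|·Σ_{y~0}: d/du E_u g_N = (1/(1−u)) E_u[a Σ_{y~0, 0↮y} φ_N(a,|C(y)|)], a = |C(0)| < N (else φ_N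
= 0); the kernel bound a·φ_N(a,b) = a·min(b,N−a)⁺/N ≤ min(a,b) gives E_{p_c} g_N − E_p g_N ≤
∫_p^{p_c} m(u)du/(1−u); finally θ(p_c) ≤ E_{p_c} g_N (g_N = 1 on {|C| = ∞}) and E_p g_N → θ(p) = 0
as N → ∞ for p < p_c (theta_eq_zero_of_lt_criticalProb_holds + dominated convergence). For p < 0 the
extra piece of the integral is ≥ 0. Grimmett1999 p.105 (C¹ in p of finite-volume qu -/
@[route_item "route-CriticalPhenomena-PercMinContact"]
def SwallowInequality : Prop :=
  ∀ p : ℝ, p < Literature.Probability.Percolation.criticalProb (Literature.Probability.LatticeModels.zdGraph 3) 0 → ENNReal.ofReal (Literature.Probability.Percolation.theta (Literature.Probability.LatticeModels.zdGraph 3) 0 (Literature.Probability.Percolation.criticalProbI 3)) ≤ ∫⁻ u in Set.Ioo p (Literature.Probability.Percolation.criticalProb (Literature.Probability.LatticeModels.zdGraph 3) 0), ENNReal.ofReal ((1 - u)⁻¹) * (∫⁻ ω, ∑ y ∈ (Literature.Probability.LatticeModels.zdGraph 3).neighborFinset (0 : Literature.Probability.LatticeModels.Site 3), (Literature.Probability.Percolation.openConn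 (0 : Literature.Probability.LatticeModels.Site 3) y)ᶜ.indicator (fun ω => min ((Literature.Probability.Percolation.openCluster ω 0).encard : ENNReal) ((Literature.Probability.Percolation.openCluster ω y).encard : ENNReal)) ω ∂(Literature.Probability.Percolation.bondPercolation (Literature.Probability.LatticeModels.zdGraph 3) (Set.projIcc (0 : ℝ) 1 zero_le_one u)))

/-- item stmt-CriticalPhenomena-11501 · support · rank 9 · closed · proved by Summit.CriticalPhenomena.PercolationContinuityZ3.Theorems.logMomentConverse_proof @ df14479e0a14 (prover) · by planner
sources: Grimmett1999, LyonsPeres2016, AizenmanKestenNewman1987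
[support] SHARPNESS MODULO A LOG-MOMENT (card C3): if θ(p_c) = 0 and E_{p_c}[log(1 + |C(0)|)] < ∞
then ∫_{(0,p_c)} m(u) du < ∞ (so SwallowTail holds with any p). Proof: in the monotone coupling
(labelMeasure, configOfLabels, map_configOfLabels_holds) let N_sw count the levels u ∈ (0,p_c) at
which an edge of ∂C_u⁻(0) with label u opens onto a cluster of size ≥ |C_u⁻(0)| (a swallow); each
swallow at least doubles |C(0)| and C_u(0) ⊆ C_{p_c}(0), so N_sw ≤ log₂|C_{p_c}(0)| pathwise (finite
a.s. when θ(p_c) = 0); the compensator identity E N_sw = ∫_0^{p_c} (1−u)⁻¹ E_u[Σ_{e∈∂C(0)}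
1{|C(y_e)| ≥ |C(0)|}] du (label of e independent of the other labels; Tonelli) and the
transport/reflection bound m(u) ≤ 2 E_u[Σ_{e∈∂C(0)} 1{|C(y_e)| ≥ |C(0)|}] (min(a,b) ≤ a1{b≥a} +
b1{a>b}; the point reflection x ↦ y − x swaps 0 and y) give ∫_0^{p_c} m du ≤ ∫_0^{p_c} m du/(1−u) ≤
2 E N_sw ≤ (2/log 2) E log(1+|C_{p_c}(0)|) < ∞. Records that SwallowTail is not stronger than the
conjunct by more than a logarithmic moment at p_c. [difficulty: M] -/
@[route_item "route-CriticalPhenomena-PercMinContact"]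
def LogMomentConverse : Prop :=
  Literature.Probability.Percolation.theta (Literature.Probability.LatticeModels.zdGraph 3) 0 (Literature.Probability.Percolation.criticalProbI 3) = 0 → (∫⁻ ω, ENNReal.ofReal (Real.log ((Literature.Probability.Percolation.openCluster ω (0 : Literature.Probability.LatticeModels.Site 3)).ncard + 1)) ∂(Literature.Probability.Percolation.bondPercolation (Literature.Probability.LatticeModels.zdGraph 3) (Literature.Probability.Percolation.criticalProbI 3))) < ⊤ → ∫⁻ u in Set.Ioo 0 (Literature.Probability.Percolation.criticalProb (Literature.Probability.LatticeModels.zdGraph 3) 0), (∫⁻ ω, ∑ y ∈ (Literature.Probability.LatticeModels.zdGraph 3).neighborFinset (0 : Literature.Probability.LatticeModels.Site 3), (Literature.Probability.Percolation.openConn (0 : Literature.Probability.LatticeModels.Site 3) y)ᶜ.indicator (fun ω => min ((Literature.Probability.Percolation.openCluster ω 0).encard : ENNReal) ((Literature.Probability.Percolation.openCluster ω y).encard : ENNReal)) ω ∂(Literature.Probability.Percolation.bondPercolation (Literature.Probability.LatticeModels.zdGraph 3) (Set.projIcc (0 : ℝ) 1 zero_le_one u))) < ⊤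

/-- item stmt-CriticalPhenomena-11502 · support · rank 9 · closed · proved by Summit.CriticalPhenomena.PercolationContinuityZ3.Theorems.ExponentGlue_proof @ 182f2fa03f12 (prover) · by planner
sources: Grimmett1999
[support] MinContactExponent → SwallowTail: with p := max(0, p_c/2), ∫_{(p,p_c)} m ≤ ∫
C(p_c−u)^{−a₀} du = C (p_c−p)^{1−a₀}/(1−a₀) < ∞ for a₀ < 1 (if a₀ ≤ 0 the integrand is bounded);
lintegral monotonicity needs no measurability of m; 0 < p_c < 1 is
Grimmett1999_criticalProb_pos_lt_one_holds. [difficulty: provable-now] -/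
@[route_item "route-CriticalPhenomena-PercMinContact"]
def ExponentGlue : Prop :=
  MinContactExponent → SwallowTail

/-- item stmt-CriticalPhenomena-11503 · support · rank 9 · closed · proved by Summit.CriticalPhenomena.PercolationContinuityZ3.Theorems.twoArmGlue_proof @ 080e58746066 (prover) · by planner
sources: Hutchcroft2021, Grimmett1999
[support] TwoArmWindow → SwallowTail: layer cake in [0,∞] (min(a,b) = Σ_{n≥1} 1{a ≥ n}1{b ≥ n} for
a,b ∈ ℕ∞; Tonelli) gives m(u) = Σ_{n≥1} Σ_{y~0} P_u(|C(0)|≥n, |C(y)|≥n, 0↮y); bound the n-th term by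
min(C n^{−λ}, 6C e^{−c n s^{Δ₀}}), s = p_c − u, split at N = ⌈(Δ₀+1) s^{−Δ₀} log(1/s)/c⌉ to get m(u)
≤ C′ s^{−Δ₀(1−λ)} log(e/s)^{1−λ} + C′ for s ≤ s₀, which is integrable on (p_c − s₀, p_c) because
Δ₀(1−λ) < 1; identify the unitInterval level with projIcc u for 0 ≤ u < p_c. [difficulty: M] -/
@[route_item "route-CriticalPhenomena-PercMinContact"]
def TwoArmGlue : Prop :=
  TwoArmWindow → SwallowTail

/-- item stmt-CriticalPhenomena-11504 · assembly · rank 1 · closed · proved by Summit.CriticalPhenomena.PercolationContinuityZ3.Theorems.percMinContactAssembly_proof @ ddd5cbf215a8 (prover) · by planner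
sources: Grimmett1999, AizenmanBarsky1987
[assembly] SwallowInequality → SwallowTail → PercolationContinuityZ3 (proved by the planner; a
prover may copy Sketch.lean's assembly_holds). -/
@[route_item "route-CriticalPhenomena-PercMinContact"]
def Assembly : Prop :=
  SwallowInequality → SwallowTail → PercolationContinuityZ3

/-! D-0027 §2.1 — DECIDING THEOREM (planner-authored via `route open/edit --closes-file`; by planner-rbadge-CriticalPhenomena-PercMinContac-0eba6928-g3-0 2026-08-17T09:34:49Z):
its hypotheses are this route's items and its conclusion the sub-problem Statement (glue_lint), and it elaborates with this file. -/

@[closes "route-CriticalPhenomena-PercMinContact"] theorem closes (h_SwallowTail : SwallowTail) (h_SwallowInequality : SwallowInequality) :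
    _root_.PercolationContinuityZ3 := by
  classical
  -- Real-analysis core, generic in the integrand `m`: a finite tail integral of `m` below `pc`
  -- and the swallow inequality `θc ≤ ∫_p^{pc} m/(1-u)` for all `p < pc` force `θc = 0`.
  have main : ∀ (m : ℝ → ENNReal) (pc θc p₀ : ℝ), pc < 1 → 0 ≤ θc → p₀ < pc →
      (∫⁻ u in Set.Ioo p₀ pc, m u) < ⊤ →
      (∀ p : ℝ, p < pc → ENNReal.ofReal θc ≤
        ∫⁻ u in Set.Ioo p pc, ENNReal.ofReal ((1 - u)⁻¹) * m u) → θc = 0 := by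
    intro m pc θc p₀ hpc1 hθ0 hp₀ hfin hineq
    by_contra hne
    have hθpos : 0 < θc := lt_of_le_of_ne hθ0 (Ne.symm hne)
    have h1pc : 0 < 1 - pc := sub_pos.2 hpc1
    have hεne : ENNReal.ofReal ((1 - pc) * θc) ≠ 0 :=
      (ENNReal.ofReal_pos.2 (mul_pos h1pc hθpos)).ne'
    obtain ⟨δ, hδpos, hδ⟩ := MeasureTheory.exists_pos_setLIntegral_lt_of_measure_lt
      (μ := volume.restrict (Set.Ioo p₀ pc)) (f := m) hfin.ne hεne
    -- a level `p ∈ [p₀, pc)` with `pc - p` small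
    obtain ⟨p, hp₀p, hppc, hsmall⟩ :
        ∃ p : ℝ, p₀ ≤ p ∧ p < pc ∧ ENNReal.ofReal (pc - p) < δ := by
      rcases eq_or_ne δ ⊤ with hδtop | hδtop
      · exact ⟨p₀, le_rfl, hp₀, by rw [hδtop]; exact ENNReal.ofReal_lt_top⟩
      · have hdpos : 0 < δ.toReal := ENNReal.toReal_pos hδpos.ne' hδtop
        refine ⟨max p₀ (pc - δ.toReal / 2), le_max_left _ _, max_lt hp₀ (by linarith), ?_⟩
        have hle : pc - max p₀ (pc - δ.toReal / 2) ≤ δ.toReal / 2 := by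
          have := le_max_right p₀ (pc - δ.toReal / 2)
          linarith
        calc ENNReal.ofReal (pc - max p₀ (pc - δ.toReal / 2))
            ≤ ENNReal.ofReal (δ.toReal / 2) := ENNReal.ofReal_le_ofReal hle
          _ < ENNReal.ofReal δ.toReal := (ENNReal.ofReal_lt_ofReal_iff hdpos).2 (by linarith)
          _ = δ := ENNReal.ofReal_toReal hδtop
    -- the restricted measure of the tail interval is small
    have hinter : Set.Ioo p pc ∩ Set.Ioo p₀ pc = Set.Ioo p pc :=
      Set.inter_eq_left.2 (Set.Ioo_subset_Ioo_left hp₀p)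
    have hμs : (volume.restrict (Set.Ioo p₀ pc)) (Set.Ioo p pc) < δ := by
      rw [Measure.restrict_apply measurableSet_Ioo, hinter, Real.volume_Ioo]
      exact hsmall
    have htail : ∫⁻ u in Set.Ioo p pc, m u < ENNReal.ofReal ((1 - pc) * θc) := by
      have h := hδ (Set.Ioo p pc) hμs
      rwa [Measure.restrict_restrict measurableSet_Ioo, hinter] at h
    -- the weight `(1 - u)⁻¹ ≤ (1 - pc)⁻¹` on `(p, pc)`
    have hW : ∀ u ∈ Set.Ioo p pc,
        ENNReal.ofReal ((1 - u)⁻¹) * m u ≤ ENNReal.ofReal ((1 - pc)⁻¹) * m u := by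
      intro u hu
      exact mul_le_mul' (ENNReal.ofReal_le_ofReal (inv_anti₀ h1pc (by linarith [hu.2]))) le_rfl
    have hWtop : ENNReal.ofReal ((1 - pc)⁻¹) ≠ ⊤ := ENNReal.ofReal_ne_top
    have hWpos : ENNReal.ofReal ((1 - pc)⁻¹) ≠ 0 :=
      (ENNReal.ofReal_pos.2 (inv_pos.2 h1pc)).ne'
    have hchain : ENNReal.ofReal θc < ENNReal.ofReal θc :=
      calc ENNReal.ofReal θc
          ≤ ∫⁻ u in Set.Ioo p pc, ENNReal.ofReal ((1 - u)⁻¹) * m u := hineq p hppc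
        _ ≤ ∫⁻ u in Set.Ioo p pc, ENNReal.ofReal ((1 - pc)⁻¹) * m u :=
            setLIntegral_mono' measurableSet_Ioo hW
        _ = ENNReal.ofReal ((1 - pc)⁻¹) * ∫⁻ u in Set.Ioo p pc, m u :=
            lintegral_const_mul' _ _ hWtop
        _ < ENNReal.ofReal ((1 - pc)⁻¹) * ENNReal.ofReal ((1 - pc) * θc) :=
            ENNReal.mul_lt_mul_right hWpos hWtop htail
        _ = ENNReal.ofReal ((1 - pc)⁻¹ * ((1 - pc) * θc)) :=
            (ENNReal.ofReal_mul (inv_nonneg.2 h1pc.le)).symm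
        _ = ENNReal.ofReal θc := by
            congr 1
            field_simp
    exact lt_irrefl _ hchain
  -- Instantiate: `pc = p_c(ℤ³) < 1` (Grimmett 1999 §1.4, PROVED in the tree), `θc = θ(p_c) ≥ 0`.
  have hpc1 : Literature.Probability.Percolation.criticalProb
      (Literature.Probability.LatticeModels.zdGraph 3) (0 : Literature.Probability.LatticeModels.Site 3) < 1 :=
    (Literature.Probability.Percolation.Grimmett1999_criticalProb_pos_lt_one_holds 3 (by norm_num)).2
  obtain ⟨p₀, hp₀, hfin⟩ := h_SwallowTail
  exact Literature.Probability.Percolation.percolationContinuityZ3_iff.mpr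
    (main _ _ (Literature.Probability.Percolation.theta (Literature.Probability.LatticeModels.zdGraph 3) 0
      (Literature.Probability.Percolation.criticalProbI 3)) p₀ hpc1 measureReal_nonneg hp₀ hfin
      h_SwallowInequality)

end Summit.CriticalPhenomena.PercolationContinuityZ3.Theses.PercMinContact
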